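import Literature.NumberTheory.ComplexMultiplication.CMAlgebraTorusReducedDegree
import Literature.RingTheory.CentralSimple.ReducedModule
import HarnessLib

/-!
# `H₁(X, ℚ) = ℚ^ι` is the reduced `End_ℚ(X)`-module of a complex torus with complex multiplication: under
# `End_ℚ(X) ≅ ∏ᵢ M_{dᵢ}(Kᵢ)`, `ℚ^ι ≅ ⊕ᵢ Kᵢ^{dᵢ}` — every simple module exactly once
# (Milne, *Complex Multiplication*, Ch. I §1 p. 8, §3 Prop. 3.1 ∕ Def. 3.2 ∕ proof of Prop. 3.3 — torus level)

Family `hodge`, lane `lit-hodgefound` (Track 2 foundations library; skeleton seat `lit-hodgefound-skel-3`, generation 61,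
row **A3-G146** «the reduced module»), layer `Literature/NumberTheory/ComplexMultiplication`, namespace
`Literature.NumberTheory.ComplexMultiplication`.  FILE 4 of the row: FILE 2 (`RingTheory/CentralSimple/ReducedModule`:
a faithful module of dimension `[B:F]_red` is `≅ ⊕ᵢ Kᵢ^{dᵢ}` compatibly with ANY `B ≅ ∏ᵢ M_{dᵢ}(Kᵢ)`) read on the
TORUS-LEVEL carrier of Layer A3 (`X = E/P(ℤ^ι)`, `End_ℚ(X) = endAlgRat P ⊆ M_ι(ℚ)` acting on `H₁(X, ℚ) = ℚ^ι` by
`Matrix.mulVec`, `2 dim X = #ι`), joined BY NAME to A3-G141 FILE 4 (`CMAlgebraTorusReducedDegree`: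
`reducedDegree_endAlgRat_le_card`, `IsCMAlgTorusRat.reducedDegree_endAlgRat_eq`,
`IsAbelianVariety.reducedDegree_endAlgRat_eq_card_iff_hodgeGroupC_comm`, Prop. 3.1's second sentence
`exists_algEquiv_endAlgRat_pi_matrix_field_of_reducedDegree_eq`).  THEOREMS ONLY (no definition, no instance, no named
fact; net debt `0`, D-0026).

## The print

J. S. Milne, *Complex Multiplication* [MilneCM2006], Ch. I §1 p. 8 (open text `paper:url-8ccc30e4daab`, p0008 L31–L33),
VERBATIM: «Let `V = Kⁿ` be the simple `B ⊗_ℚ K`-module corresponding to `σ : k → K`. Any `B ⊗_ℚ K`-module isomorphic to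
`⊕_{σ:k→K} V_σ` is said to be reduced.»; §3 p. 27 «PROPOSITION 3.1 For any abelian variety `A`, `2 dim A ≥ [End⁰(A):ℚ]_red`.
When equality holds, `End⁰(A)` is a product of matrix algebras over fields. PROOF. As `End⁰(A)` is a semisimple
`ℚ`-algebra acting faithfully on the `2 dim A`-dimensional `ℚ`-vector space `H₁(A, ℚ)`, this follows from (1.2).»; p. 28
«if (a) holds, then `End⁰(A) ⊗_ℚ Ω` is a product of matrix algebras over fields and `H¹(A)` is reduced (1.2)».

## What is formalised (`P : (ι → ℝ) ≃L[ℝ] E` a period isomorphism, `X = E/P(ℤ^ι)`, `End_ℚ(X) = endAlgRat P`)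

* §1 ★★ **`exists_linearEquiv_pi_vec_of_reducedDegree_endAlgRat_eq_card`**: if `[End_ℚ(X) : ℚ]_red = #ι = 2 dim X`
  («CM», Def. 3.2) then for EVERY `e : End_ℚ(X) ≃ₐ[ℚ] ∏ᵢ M_{dᵢ}(Kᵢ)` over fields (`dᵢ ≥ 1`) there is
  `f : ℚ^ι ≃ₗ[ℚ] Πᵢ (Fin dᵢ → Kᵢ)` with `f (M *ᵥ v) = e M • f v` — `H₁(X, ℚ)` is the reduced module, each simple
  `End_ℚ(X)`-module exactly once; the converse `reducedDegree_endAlgRat_eq_card_of_linearEquiv_pi_vec` (dimension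
  count, any `ℚ`-linear `f`) and the iff `reducedDegree_endAlgRat_eq_card_iff_exists_linearEquiv_pi_vec`.
* §2 the tree's CM notions: ★ **`IsCMAlgTorusRat.exists_linearEquiv_pi_vec`** (multiplication by a CM-algebra of full
  degree, Milne 2005 Def. 14.9 ∕ Example 3.4 — every CM torus `ℂ^Φ∕u(𝔞)` of Layer A3), and for an ABELIAN VARIETY
  ★ **`IsAbelianVariety.hodgeGroupC_comm_iff_exists_linearEquiv_pi_vec`** (`Hg(X)(ℂ)` commutative ⟺ `ℚ^ι ≅ ⊕ᵢ Kᵢ^{dᵢ}`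
  compatibly with a given splitting `e`).

## References

* [MilneCM2006] J. S. Milne, *Complex Multiplication* (2006/2020), Ch. I §1 p. 8 (the reduced module), §3 Prop. 3.1,
  Def. 3.2, proof of Prop. 3.3 (pp. 27–28).
* [Lange2023AbelianVarietiesComplex] H. Lange, *Abelian Varieties over the Complex Numbers* (2023), §7.2.3 Prop. 7.2.6.
-/

noncomputable section

open Module Matrix

namespace Literature.NumberTheory.ComplexMultiplication

open Literature.RingTheory.CentralSimple
open Literature.Geometry.Kaehler
open Literature.Geometry.Kaehler.ComplexTorus

section Torus

variable {ι : Type} [Fintype ι] [DecidableEq ι] {E : Type} [NormedAddCommGroup E] [NormedSpace ℂ E]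
  (P : (ι → ℝ) ≃L[ℝ] E)
  {κ : Type*} [Fintype κ] {K : κ → Type*} [∀ i, Field (K i)] [∀ i, Algebra ℚ (K i)] [∀ i, FiniteDimensional ℚ (K i)]
  {d : κ → ℕ}

/-! ## §1 `[End_ℚ(X) : ℚ]_red = 2 dim X` ⟺ `ℚ^ι` is the reduced `End_ℚ(X)`-module -/

/-- **«`H₁(A, ℚ)` ∕ `H¹(A)` IS REDUCED» AT TORUS LEVEL: if `[End_ℚ(X) : ℚ]_red = #ι = 2 dim X`, then for EVERY
`e : End_ℚ(X) ≃ₐ[ℚ] ∏ᵢ M_{dᵢ}(Kᵢ)` onto a product of matrix algebras over fields (`dᵢ ≥ 1`; such `e` exist by Prop. 3.1's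
second sentence, A3-G141 FILE 4) there is a `ℚ`-linear `f : ℚ^ι ≃ Πᵢ (Fin dᵢ → Kᵢ) = ⊕ᵢ Kᵢ^{dᵢ}` with
`f (M *ᵥ v) = e M • f v`** — `H₁(X, ℚ) = ℚ^ι` is the reduced module (each simple `End_ℚ(X)`-module exactly once):
`End_ℚ(X)` acts faithfully on `ℚ^ι` of dimension `#ι = [End_ℚ(X) : ℚ]_red`, and FILE 2 §4 applies (semisimplicity of
`End_ℚ(X)` comes with `e`). [cite: MilneCM2006, Ch. I §3 Prop. 3.1 (p. 27), proof of Prop. 3.3 (p. 28); §1 p. 8 (the reduced module)] -/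
theorem exists_linearEquiv_pi_vec_of_reducedDegree_endAlgRat_eq_card [∀ i, NeZero (d i)]
    (h : reducedDegree ℚ ↥(endAlgRat P) = Fintype.card ι)
    (e : ↥(endAlgRat P) ≃ₐ[ℚ] Π i, Matrix (Fin (d i)) (Fin (d i)) (K i)) :
    ∃ f : (ι → ℚ) ≃ₗ[ℚ] (Π i, Fin (d i) → K i),
      ∀ (M : ↥(endAlgRat P)) (v : ι → ℚ), f ((M : Matrix ι ι ℚ).mulVec v) = e M • f v := by
  -- `ℚ^ι` as a faithful `End_ℚ(X)`-module: `M • v = M *ᵥ v` (Mathlib's `Matrix.mulVec` module structure, inherited by the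
  -- subalgebra `End_ℚ(X) ⊆ M_ι(ℚ)`)
  have hsmul : ∀ (M : ↥(endAlgRat P)) (v : ι → ℚ), M • v = (M : Matrix ι ι ℚ).mulVec v := fun _ _ => rfl
  haveI : IsScalarTower ℚ ↥(endAlgRat P) (ι → ℚ) := ⟨fun c M v => by
    rw [hsmul, hsmul, Subalgebra.coe_smul, Matrix.smul_mulVec]⟩
  have hfaith : ∀ M : ↥(endAlgRat P), (∀ v : ι → ℚ, M • v = 0) → M = 0 := by
    intro M hM
    have h1 : (M : Matrix ι ι ℚ) = 0 :=
      Matrix.ext_iff_mulVec.mpr fun v => by rw [Matrix.zero_mulVec, ← hsmul]; exact hM v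
    exact Subtype.ext h1
  have hdim : finrank ℚ (ι → ℚ) = reducedDegree ℚ ↥(endAlgRat P) := by
    rw [finrank_fintype_fun_eq_card, h]
  obtain ⟨f, hf⟩ := exists_linearEquiv_pi_vec_of_faithful_finrank_eq_reducedDegree (F := ℚ) e hfaith hdim
  exact ⟨f, fun M v => by rw [← hsmul, hf]⟩

/-- Conversely, **if `ℚ^ι ≅ ⊕ᵢ Kᵢ^{dᵢ}` (even just `ℚ`-linearly) for some `End_ℚ(X) ≃ₐ[ℚ] ∏ᵢ M_{dᵢ}(Kᵢ)`, then
`[End_ℚ(X) : ℚ]_red = #ι`** (`#ι = dim ℚ^ι = Σ dᵢ[Kᵢ:ℚ] = [∏ M_{dᵢ}(Kᵢ) : ℚ]_red`).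
[cite: MilneCM2006, Ch. I §3 Def. 3.2 and proof of Prop. 3.3 («The converse is equally easy», p. 28); §1 (1.2) (p. 9)] -/
theorem reducedDegree_endAlgRat_eq_card_of_linearEquiv_pi_vec
    (e : ↥(endAlgRat P) ≃ₐ[ℚ] Π i, Matrix (Fin (d i)) (Fin (d i)) (K i)) (f : (ι → ℚ) ≃ₗ[ℚ] (Π i, Fin (d i) → K i)) :
    reducedDegree ℚ ↥(endAlgRat P) = Fintype.card ι := by
  rw [← finrank_fintype_fun_eq_card (R := ℚ) (η := ι), f.finrank_eq, reducedDegree_eq_of_algEquiv e,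
    finrank_pi_vec_eq_sum d, reducedDegree_pi]
  refine Finset.sum_congr rfl fun i _ => ?_
  rcases Nat.eq_zero_or_pos (d i) with h0 | hpos
  · haveI : IsEmpty (Fin (d i)) := by rw [h0]; infer_instance
    rw [reducedDegree_eq_zero_of_subsingleton, h0, zero_mul]
  · haveI : Nonempty (Fin (d i)) := ⟨⟨0, hpos⟩⟩
    rw [reducedDegree_eq_mul_of_isCentral_isSimple (K := K i) (B := Matrix (Fin (d i)) (Fin (d i)) (K i))
      (d := d i) (by rw [Module.finrank_matrix, Fintype.card_fin, Module.finrank_self, mul_one, sq])]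

/-- **`[End_ℚ(X) : ℚ]_red = 2 dim X` ⟺ `ℚ^ι` IS THE REDUCED MODULE**: for `e : End_ℚ(X) ≃ₐ[ℚ] ∏ᵢ M_{dᵢ}(Kᵢ)` over fields
(`dᵢ ≥ 1`), equality in Prop. 3.1 holds iff `ℚ^ι ≅ ⊕ᵢ Kᵢ^{dᵢ}` compatibly with `e`.
[cite: MilneCM2006, Ch. I §3 Prop. 3.1, Def. 3.2, proof of Prop. 3.3 (pp. 27–28); §1 p. 8] -/
theorem reducedDegree_endAlgRat_eq_card_iff_exists_linearEquiv_pi_vec [∀ i, NeZero (d i)]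
    (e : ↥(endAlgRat P) ≃ₐ[ℚ] Π i, Matrix (Fin (d i)) (Fin (d i)) (K i)) :
    reducedDegree ℚ ↥(endAlgRat P) = Fintype.card ι ↔
      ∃ f : (ι → ℚ) ≃ₗ[ℚ] (Π i, Fin (d i) → K i),
        ∀ (M : ↥(endAlgRat P)) (v : ι → ℚ), f ((M : Matrix ι ι ℚ).mulVec v) = e M • f v :=
  ⟨fun h => exists_linearEquiv_pi_vec_of_reducedDegree_endAlgRat_eq_card P h e,
    fun ⟨f, _⟩ => reducedDegree_endAlgRat_eq_card_of_linearEquiv_pi_vec P e f⟩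

/-! ## §2 The tree's CM notions: `IsCMAlgTorusRat`, and `Hg(X)` commutative for an abelian variety -/

variable {P} in
/-- **A torus with multiplication by a CM-algebra of full degree (Milne 2005 Def. 14.9; every CM torus `ℂ^Φ∕u(𝔞)` of
Layer A3) has `H₁(X, ℚ) = ℚ^ι ≅ ⊕ᵢ Kᵢ^{dᵢ}` compatibly with any `End_ℚ(X) ≃ₐ[ℚ] ∏ᵢ M_{dᵢ}(Kᵢ)`** (Example 3.4 with the
reduced module). [cite: MilneCM2006, Ch. I §3 Example 3.4 and proof of Prop. 3.3 (p. 28); §1 p. 8] [cite: Milne2005ShimuraVarieties, §14 Def. 14.9] -/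
theorem IsCMAlgTorusRat.exists_linearEquiv_pi_vec [∀ i, NeZero (d i)] {t : Type} [Fintype t] {L : t → Type}
    [∀ i, Field (L i)] [∀ i, NumberField (L i)] {ρ : (Π i, L i) →ₐ[ℚ] Matrix ι ι ℚ} (h : IsCMAlgTorusRat P ρ)
    (e : ↥(endAlgRat P) ≃ₐ[ℚ] Π i, Matrix (Fin (d i)) (Fin (d i)) (K i)) :
    ∃ f : (ι → ℚ) ≃ₗ[ℚ] (Π i, Fin (d i) → K i),
      ∀ (M : ↥(endAlgRat P)) (v : ι → ℚ), f ((M : Matrix ι ι ℚ).mulVec v) = e M • f v :=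
  exists_linearEquiv_pi_vec_of_reducedDegree_endAlgRat_eq_card P h.reducedDegree_endAlgRat_eq e

variable {P} in
/-- **For an ABELIAN VARIETY `X = E/P(ℤ^ι)` and a splitting `e : End_ℚ(X) ≃ₐ[ℚ] ∏ᵢ M_{dᵢ}(Kᵢ)` over fields (`dᵢ ≥ 1`):
`Hg(X)(ℂ)` is commutative (Deligne's «of CM-type») iff `H₁(X, ℚ) = ℚ^ι ≅ ⊕ᵢ Kᵢ^{dᵢ}` compatibly with `e`** (A3-G141 FILE
4's `reducedDegree_endAlgRat_eq_card_iff_hodgeGroupC_comm` with §1).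
[cite: MilneCM2006, Ch. I §3 Def. 3.2 and proof of Prop. 3.3 (pp. 27–28)] [cite: Lange2023AbelianVarietiesComplex, §7.2.3 Prop. 7.2.6] -/
theorem _root_.Literature.Geometry.Kaehler.ComplexTorus.IsAbelianVariety.hodgeGroupC_comm_iff_exists_linearEquiv_pi_vec
    [∀ i, NeZero (d i)] (hX : IsAbelianVariety P)
    (e : ↥(endAlgRat P) ≃ₐ[ℚ] Π i, Matrix (Fin (d i)) (Fin (d i)) (K i)) :
    (∀ M ∈ hodgeGroupC P, ∀ N ∈ hodgeGroupC P, M * N = N * M) ↔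
      ∃ f : (ι → ℚ) ≃ₗ[ℚ] (Π i, Fin (d i) → K i),
        ∀ (M : ↥(endAlgRat P)) (v : ι → ℚ), f ((M : Matrix ι ι ℚ).mulVec v) = e M • f v := by
  rw [← hX.reducedDegree_endAlgRat_eq_card_iff_hodgeGroupC_comm]
  exact reducedDegree_endAlgRat_eq_card_iff_exists_linearEquiv_pi_vec P e

end Torus

end Literature.NumberTheory.ComplexMultiplication
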